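import Mathlib
import HarnessLib
import Summits.ResolutionOfSingularities.ResolutionOfSingularities.Theorems.WildQuotientsWildQuotientResolutionS1aCuspMemberQ
import Summits.ResolutionOfSingularities.ResolutionOfSingularities.Theorems.WildQuotientsWildQuotientResolutionS1aQhTailSection

/-!
# S1a — R4c cusp COVER brick at `Q`, CHART-RING FORM: a prime of a producer chart ring over `W_Q` (`[N(y)]` or `[v]`) containing the residual sections
# (`u₀′`, `t̂`) misses the member norm `N_R(ĥ_Q)` — hence misses the chart value `b̂` of `b_{Q,1}` / `b_{Q,2}`

[OURS · L1 W4.5c · leafhand-res-wildquotients-7 g1] — NOT statements of the manuscript; counted 0; AI-level work, weaker than expert review. Crux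
stmt-ResolutionOfSingularities-17941 `CyclicQuotientFourfolds`, line `s1a-logminvertex` v13 (`stub_reachLowerInFX`), R4c `cusp_killsIn_two` (crux-dir skeleton v2,
`Lines/s1a_logminvertex-R4c-PROGRESS-v2.md`, COVER obligation 1 at `Q`: "residual points `R₁₁ ⊆ U_{Q,1}`, `R₁₂ ⊆ U_{Q,2}`"), hand-7 g0 repair census item (a)/(C1) at `Q`.

The `Q`-twin of ✓`KillCert.QhSym.cuspO_norms_not_mem_of_residual` (p820215): weights `(3,1,2)`, shift `2`, recentred tail
`T_Q = x₂² + 2x₁x₂ + 2c·x₂ + (1−3a)x₁² − x₁³`, localised root `hh_Q = ∏ₗ(x₁ + a + l·x₀)`, member norm `N_R(ĥ_Q)`, `ĥ_Q = 2(1−3a)u₁′ + 2s·u₂′ − 3s·u₁′²`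
(both member charts `U_{Q,1} ⊂ [N(y)]` and `U_{Q,2} ⊂ [v]` have `E b = N_R(ĥ_Q)^{dbar}/1 · (1/c)^{p}`, ✓`exists_cuspQ_memberChart_rel` / ✓`exists_cuspQv_memberChart_rel`).
The ring certificate ✓`Cusp.cuspQ_hunit_not_mem` needs `y′ ∉ Q` (automatic on `[N(y)]`); on `[v]` (where `v′` is the unit) the case `y′ ∈ Q` is the new
elementary lemma `Cusp.cuspQ_hunit_not_mem_of_Y_mem`. Transport through the pinned model `Φ : R_c ≃ k[s,x′][1/q]` exactly as at `O`
(✓`QhAway.qhc_tail_eq` + ✓`QhSym.subst_cuspTailQ`, ✓`QhAway.qhc_map_normR_hHatQ`).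
* `Cusp.cuspQ_hunit_not_mem_of_Y_mem` — ring lemma: `X₀, T′, Y ∈ Q`, `V ∉ Q`, `2, c` units ⇒ `h_Q ∉ Q` and `N(h_Q) ∉ Q`;
* ★ `cuspQ_hHat_not_mem_of_residual` — `u₀′/1, t̂/1 ∈ Q` ⇒ `N_R(ĥ_Q)/1 ∉ Q` and `ĥ_Q/1 ∉ Q`, on any producer chart over `W_Q` whose model inverts `N(y′)` OR `v′`;
* ★ `cuspQ_bHat_not_mem_of_residualSections` — the same from the residual SECTIONS, concluding `(N_R(ĥ_Q)^{d′})/1 · (1/c)^{e} ∉ Q`.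
-/

set_option linter.dupNamespace false

noncomputable section

open MvPolynomial
open Literature.AlgebraicGeometry.Resolution
open scoped LaurentPolynomial
open Summit.ResolutionOfSingularities.ResolutionOfSingularities.Theorems.WildQuotientResolution.S1
open Summit.ResolutionOfSingularities.ResolutionOfSingularities.Theorems.WildQuotientResolution.S1.CoarseChart
open Summit.ResolutionOfSingularities.ResolutionOfSingularities.Theorems.WildQuotientResolution.S1.ProducerStep
open Summit.ResolutionOfSingularities.ResolutionOfSingularities.Theorems.WildQuotientResolution.S1.ReesBigrading
open Summit.ResolutionOfSingularities.ResolutionOfSingularities.Theorems.WildQuotientResolution.S1.NodeTransport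
open Summit.ResolutionOfSingularities.ResolutionOfSingularities.Theorems.WildQuotientResolution.S1.CobordantTransport
open Summit.ResolutionOfSingularities.ResolutionOfSingularities.Theorems.WildQuotientResolution.S1.NodeAway
open Summit.ResolutionOfSingularities.ResolutionOfSingularities.Theorems.WildQuotientResolution.S1.CentreAway
open Summit.ResolutionOfSingularities.ResolutionOfSingularities.Theorems.WildQuotientResolution.S1.BlowupCharts
open Summit.ResolutionOfSingularities.ResolutionOfSingularities.Theorems.WildQuotientResolution.S1.KillCert
open Summit.ResolutionOfSingularities.ResolutionOfSingularities.Theorems.WildQuotientResolution.S1.GameFrame.GModel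

/-! ## The ring lemma for the chart `[v]`: the case `y′ ∈ Q` -/

namespace Summit.ResolutionOfSingularities.ResolutionOfSingularities.Theorems.WildQuotientResolution.S1.Cusp

/-- **The member-row unit at `Q` on the chart `[v]`, case `Y′ ∈ Q`.** In any commutative ring, for a prime `Q ∋ X₀′, T′, Y′` not containing `V′`,
with `2` and `c` units: `h_Q = 2(1 − 3a)Y′ + 2sV′ − 3sY′² ∉ Q` (else `s ∈ Q`, then `T′ ≡ 2cV′ ∈ Q`), nor its norm (factors `≡ h_Q mod X₀′`).
Complement of ✓`cuspQ_hunit_not_mem` (which covers `Y′ ∉ Q`). [OURS · L1 W4.5c · R4c] -/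
theorem cuspQ_hunit_not_mem_of_Y_mem {A : Type} [CommRing A] (Q : Ideal A) [hQ : Q.IsPrime] {p : ℕ} [NeZero p] (s X₀ Y V a c : A) (cc' : ZMod p → A)
    (h2 : IsUnit (2 : A)) (hc : IsUnit c) (hV : V ∉ Q)
    (hX₀ : X₀ ∈ Q) (hT : s ^ 2 * V ^ 2 + 2 * s * V * Y + 2 * c * V + (1 - 3 * a) * Y ^ 2 - s * Y ^ 3 ∈ Q) (hY : Y ∈ Q) :
    (2 * (1 - 3 * a) * Y + 2 * s * V - 3 * s * Y ^ 2) ∉ Q ∧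
      (∏ l : ZMod p, (2 * (1 - 3 * a) * (Y + cc' l * X₀) + 2 * s * V - 3 * s * (Y + cc' l * X₀) ^ 2)) ∉ Q := by
  have hQ' : (2 * (1 - 3 * a) * Y + 2 * s * V - 3 * s * Y ^ 2) ∉ Q := by
    intro hh
    have h2sV : 2 * (s * V) ∈ Q := by
      have : 2 * (s * V) = (2 * (1 - 3 * a) * Y + 2 * s * V - 3 * s * Y ^ 2) - Y * (2 * (1 - 3 * a) - 3 * s * Y) := by ring
      rw [this]; exact Q.sub_mem hh (Q.mul_mem_right _ hY)
    rcases hQ.mem_or_mem h2sV with h2Q | hsV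
    · exact hQ.ne_top (Q.eq_top_of_isUnit_mem h2Q h2)
    rcases hQ.mem_or_mem hsV with hs | hV'
    · have h2cV : 2 * c * V ∈ Q := by
        have : 2 * c * V = (s ^ 2 * V ^ 2 + 2 * s * V * Y + 2 * c * V + (1 - 3 * a) * Y ^ 2 - s * Y ^ 3) - s * (s * V ^ 2 + 2 * V * Y - Y ^ 3) - Y * ((1 - 3 * a) * Y) := by ring
        rw [this]; exact Q.sub_mem (Q.sub_mem hT (Q.mul_mem_right _ hs)) (Q.mul_mem_right _ hY)
      rcases hQ.mem_or_mem h2cV with h2c | hV'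
      · rcases hQ.mem_or_mem h2c with h2Q | hcQ
        · exact hQ.ne_top (Q.eq_top_of_isUnit_mem h2Q h2)
        · exact hQ.ne_top (Q.eq_top_of_isUnit_mem hcQ hc)
      · exact hV hV'
    · exact hV hV'
  refine ⟨hQ', prod_not_mem_of_sub_mem Q _ _ _ hQ' fun l _ => ?_⟩
  have : 2 * (1 - 3 * a) * (Y + cc' l * X₀) + 2 * s * V - 3 * s * (Y + cc' l * X₀) ^ 2 - (2 * (1 - 3 * a) * Y + 2 * s * V - 3 * s * Y ^ 2) =
      (2 * (1 - 3 * a) * cc' l - 3 * s * (2 * Y * cc' l + cc' l ^ 2 * X₀)) * X₀ := by ring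
  rw [this]; exact Q.mul_mem_left _ hX₀

end Summit.ResolutionOfSingularities.ResolutionOfSingularities.Theorems.WildQuotientResolution.S1.Cusp

/-! ## Transport to the producer chart rings over `W_Q` -/

namespace Summit.ResolutionOfSingularities.ResolutionOfSingularities.Theorems.WildQuotientResolution.S1.KillCert.QhAway

variable {k : Type} [Field k] (a c : k) (σ : (MvPolynomial (Fin 4) k) ≃+* (MvPolynomial (Fin 4) k)) (hC : ∀ a : k, σ (C a) = C a)
  (h0 : σ (X 0) = X 0) (h1 : σ (X 1) = X 1 + X 0) (h2 : σ (X 2) = X 2) (h3 : σ (X 3) = X 3 + (X 2 ^ 2 + 2 * X 1 * X 2 + C (2 * c) * X 2 + C (1 - 3 * a) * X 1 ^ 2 - X 1 ^ 3 : MvPolynomial (Fin 4) k))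
  (hh : (MvPolynomial (Fin 4) k)) (hσh : σ hh = hh)
  {p : ℕ} (hp : 0 < p) (hσpL : ∀ y : (Localization.Away hh), (⇑(sigmaAway σ hσh))^[p] y = y)
  (hσJ : ∀ n : ℕ, ((weightedFiltration (fun i => algebraMap (MvPolynomial (Fin 4) k) (Localization.Away hh) (X ((![0, 1, 2] : Fin 3 → Fin 4) i))) (![3, 1, 2] : Fin 3 → ℕ)).ideal n).map ((sigmaAway σ hσh) : (Localization.Away hh) →+* (Localization.Away hh)) ≤ (weightedFiltration (fun i => algebraMap (MvPolynomial (Fin 4) k) (Localization.Away hh) (X ((![0, 1, 2] : Fin 3 → Fin 4) i))) (![3, 1, 2] : Fin 3 → ℕ)).ideal n)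
  (ht : algebraMap (MvPolynomial (Fin 4) k) (Localization.Away hh) (X 2 ^ 2 + 2 * X 1 * X 2 + C (2 * c) * X 2 + C (1 - 3 * a) * X 1 ^ 2 - X 1 ^ 3 : MvPolynomial (Fin 4) k) ∈ (weightedFiltration (fun i => algebraMap (MvPolynomial (Fin 4) k) (Localization.Away hh) (X ((![0, 1, 2] : Fin 3 → Fin 4) i))) (![3, 1, 2] : Fin 3 → ℕ)).ideal 2)
  {mg : ℕ} (mo : Fin mg → ℕ) (𝒜 : (Π j : Fin mg, ZMod (mo j)) → AddSubgroup (Localization.Away hh)) [GradedRing 𝒜]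
  {dbar : ℕ} (y : ↥(𝒜 0)) (hy : y ∈ (traceFiltration 𝒜 (fun i => algebraMap (MvPolynomial (Fin 4) k) (Localization.Away hh) (X ((![0, 1, 2] : Fin 3 → Fin 4) i))) (![3, 1, 2] : Fin 3 → ℕ)).ideal dbar) (hσy : (sigmaAway σ hσh) (y : (Localization.Away hh)) = y)
  {qd : MvPolynomial (Option (Fin 4)) k} (hq0 : qd ≠ 0)
  (Φ : (ChartRing 𝒜 (fun i => algebraMap (MvPolynomial (Fin 4) k) (Localization.Away hh) (X ((![0, 1, 2] : Fin 3 → Fin 4) i))) (![3, 1, 2] : Fin 3 → ℕ) dbar y hy) ≃+* Localization.Away qd)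
  (hΦa : ∀ a' : (MvPolynomial (Fin 4) k), Φ ((algebraMap ↥(cobordantAlgebra (fun i => algebraMap (MvPolynomial (Fin 4) k) (Localization.Away hh) (X ((![0, 1, 2] : Fin 3 → Fin 4) i))) (![3, 1, 2] : Fin 3 → ℕ)) (ChartRing 𝒜 (fun i => algebraMap (MvPolynomial (Fin 4) k) (Localization.Away hh) (X ((![0, 1, 2] : Fin 3 → Fin 4) i))) (![3, 1, 2] : Fin 3 → ℕ) dbar y hy)) (algebraMap (Localization.Away hh) ↥(cobordantAlgebra (fun i => algebraMap (MvPolynomial (Fin 4) k) (Localization.Away hh) (X ((![0, 1, 2] : Fin 3 → Fin 4) i))) (![3, 1, 2] : Fin 3 → ℕ)) (algebraMap (MvPolynomial (Fin 4) k) (Localization.Away hh) a'))) = (algebraMap (MvPolynomial (Option (Fin 4)) k) (Localization.Away qd)) (cobordantAlgebra.subst k (![3, 1, 2, 0] : Fin 4 → ℕ) a'))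
  (hΦs : Φ ((algebraMap ↥(cobordantAlgebra (fun i => algebraMap (MvPolynomial (Fin 4) k) (Localization.Away hh) (X ((![0, 1, 2] : Fin 3 → Fin 4) i))) (![3, 1, 2] : Fin 3 → ℕ)) (ChartRing 𝒜 (fun i => algebraMap (MvPolynomial (Fin 4) k) (Localization.Away hh) (X ((![0, 1, 2] : Fin 3 → Fin 4) i))) (![3, 1, 2] : Fin 3 → ℕ) dbar y hy)) (cobordantAlgebra.s (fun i => algebraMap (MvPolynomial (Fin 4) k) (Localization.Away hh) (X ((![0, 1, 2] : Fin 3 → Fin 4) i))) (![3, 1, 2] : Fin 3 → ℕ))) = (algebraMap (MvPolynomial (Option (Fin 4)) k) (Localization.Away qd)) (X none))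
  (hΦu : ∀ i : Fin 3, Φ ((algebraMap ↥(cobordantAlgebra (fun i => algebraMap (MvPolynomial (Fin 4) k) (Localization.Away hh) (X ((![0, 1, 2] : Fin 3 → Fin 4) i))) (![3, 1, 2] : Fin 3 → ℕ)) (ChartRing 𝒜 (fun i => algebraMap (MvPolynomial (Fin 4) k) (Localization.Away hh) (X ((![0, 1, 2] : Fin 3 → Fin 4) i))) (![3, 1, 2] : Fin 3 → ℕ) dbar y hy)) (cobordantAlgebra.u' (fun i => algebraMap (MvPolynomial (Fin 4) k) (Localization.Away hh) (X ((![0, 1, 2] : Fin 3 → Fin 4) i))) (![3, 1, 2] : Fin 3 → ℕ) i)) = (algebraMap (MvPolynomial (Option (Fin 4)) k) (Localization.Away qd)) (X (some ((![0, 1, 2] : Fin 3 → Fin 4) i))))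

set_option maxHeartbeats 1600000 in
set_option synthInstance.maxHeartbeats 400000 in
include hC h0 h1 h2 h3 hΦa hΦs hΦu hσy hq0 in
/-- ★ **Residual primes of a producer chart ring over `W_Q` miss the member norm `N_R(ĥ_Q)`.** Let `Q` be a prime of the chart ring `R_c` of a producer chart
of the level-1 root at `Q` (weights `(3,1,2)`) whose pinned model inverts `subst hh_Q` and EITHER the norm `N(y′)` (chart `[N(y)]`) OR `v′` (chart `[v]`).
If `Q` contains `u₀′/1` and the tail `t̂/1` (`t̂ = T_Q·T²`), then `N_R(ĥ_Q)/1 ∉ Q` and `ĥ_Q/1 ∉ Q`. Transport of ✓`Cusp.cuspQ_hunit_not_mem` /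
`Cusp.cuspQ_hunit_not_mem_of_Y_mem` through `Φ`. [OURS · L1 W4.5c · R4c (C1) at `Q`] -/
theorem cuspQ_hHat_not_mem_of_residual [NeZero p] (hk2 : (2 : k) ≠ 0) (hk3 : (3 : k) ≠ 0) (hc0 : c ≠ 0) (ha9 : a * 9 = 4)
    (hQ1 : 2 * c = 3 * a ^ 2) (hQ2 : c ^ 2 = a ^ 3)
    (hhh : hh = ∏ l : ZMod p, (X 1 + C a + (l.val : (MvPolynomial (Fin 4) k)) * X 0))
    (hUh : IsUnit ((algebraMap (MvPolynomial (Option (Fin 4)) k) (Localization.Away qd)) (cobordantAlgebra.subst k (![3, 1, 2, 0] : Fin 4 → ℕ) hh)))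
    (hcov : IsUnit ((algebraMap (MvPolynomial (Option (Fin 4)) k) (Localization.Away qd)) (∏ l : ZMod p, (X (some 1) + (l.val : (MvPolynomial (Option (Fin 4)) k)) * (X none ^ 2 * X (some 0))))) ∨ IsUnit ((algebraMap (MvPolynomial (Option (Fin 4)) k) (Localization.Away qd)) (X (some 2))))
    (Q : Ideal (ChartRing 𝒜 (fun i => algebraMap (MvPolynomial (Fin 4) k) (Localization.Away hh) (X ((![0, 1, 2] : Fin 3 → Fin 4) i))) (![3, 1, 2] : Fin 3 → ℕ) dbar y hy)) [hQ : Q.IsPrime]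
    (hu0 : (algebraMap ↥(cobordantAlgebra (fun i => algebraMap (MvPolynomial (Fin 4) k) (Localization.Away hh) (X ((![0, 1, 2] : Fin 3 → Fin 4) i))) (![3, 1, 2] : Fin 3 → ℕ)) (ChartRing 𝒜 (fun i => algebraMap (MvPolynomial (Fin 4) k) (Localization.Away hh) (X ((![0, 1, 2] : Fin 3 → Fin 4) i))) (![3, 1, 2] : Fin 3 → ℕ) dbar y hy)) (cobordantAlgebra.u' (fun i => algebraMap (MvPolynomial (Fin 4) k) (Localization.Away hh) (X ((![0, 1, 2] : Fin 3 → Fin 4) i))) (![3, 1, 2] : Fin 3 → ℕ) 0) ∈ Q)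
    (htt : (algebraMap ↥(cobordantAlgebra (fun i => algebraMap (MvPolynomial (Fin 4) k) (Localization.Away hh) (X ((![0, 1, 2] : Fin 3 → Fin 4) i))) (![3, 1, 2] : Fin 3 → ℕ)) (ChartRing 𝒜 (fun i => algebraMap (MvPolynomial (Fin 4) k) (Localization.Away hh) (X ((![0, 1, 2] : Fin 3 → Fin 4) i))) (![3, 1, 2] : Fin 3 → ℕ) dbar y hy)) ⟨_, C_mul_T_mem_cobordantAlgebra _ _ ht⟩ ∈ Q) :
    (algebraMap ↥(cobordantAlgebra (fun i => algebraMap (MvPolynomial (Fin 4) k) (Localization.Away hh) (X ((![0, 1, 2] : Fin 3 → Fin 4) i))) (![3, 1, 2] : Fin 3 → ℕ)) (ChartRing 𝒜 (fun i => algebraMap (MvPolynomial (Fin 4) k) (Localization.Away hh) (X ((![0, 1, 2] : Fin 3 → Fin 4) i))) (![3, 1, 2] : Fin 3 → ℕ) dbar y hy)) (∏ j : ZMod p, (⇑(sigmaR (sigmaAway σ hσh) (fun i => algebraMap (MvPolynomial (Fin 4) k) (Localization.Away hh) (X ((![0, 1, 2] : Fin 3 → Fin 4) i))) (![3, 1,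 2] : Fin 3 → ℕ) hσJ hp hσpL))^[j.val] (((algebraMap (Localization.Away hh) ↥(cobordantAlgebra (fun i => algebraMap (MvPolynomial (Fin 4) k) (Localization.Away hh) (X ((![0, 1, 2] : Fin 3 → Fin 4) i))) (![3, 1, 2] : Fin 3 → ℕ))) (algebraMap (MvPolynomial (Fin 4) k) (Localization.Away hh) (C (2 * (1 - 3 * a))))) * (cobordantAlgebra.u' (fun i => algebraMap (MvPolynomial (Fin 4) k) (Localization.Away hh) (X ((![0, 1, 2] : Fin 3 → Fin 4) i))) (![3, 1, 2] : Fin 3 → ℕ) 1) + 2 * (cobordantAlgebra.s (fun i => algebraMap (MvPolynomial (Fin 4) k) (Localization.Away hh) (X ((![0, 1, 2] : Fin 3 → Fin 4) i))) (![3, 1, 2] : Fin 3 → ℕ)) * (cobordantAlgebra.u' (fun i => algebraMap (MvPolynomial (Fin 4) k) (Localization.Away hh) (X ((![0, 1, 2] : Fin 3 → Fin 4) i))) (![3, 1, 2] : Fin 3 → ℕ) 2) - 3 * (cobordantAlgebra.s (fun i => algebraMap (MvPolynomial (Fin 4) k) (Localization.Away hh) (X ((![0, 1, 2] : Fin 3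 → Fin 4) i))) (![3, 1, 2] : Fin 3 → ℕ)) * (cobordantAlgebra.u' (fun i => algebraMap (MvPolynomial (Fin 4) k) (Localization.Away hh) (X ((![0, 1, 2] : Fin 3 → Fin 4) i))) (![3, 1, 2] : Fin 3 → ℕ) 1) ^ 2)) ∉ Q ∧ (algebraMap ↥(cobordantAlgebra (fun i => algebraMap (MvPolynomial (Fin 4) k) (Localization.Away hh) (X ((![0, 1, 2] : Fin 3 → Fin 4) i))) (![3, 1, 2] : Fin 3 → ℕ)) (ChartRing 𝒜 (fun i => algebraMap (MvPolynomial (Fin 4) k) (Localization.Away hh) (X ((![0, 1, 2] : Fin 3 → Fin 4) i))) (![3, 1, 2] : Fin 3 → ℕ) dbar y hy)) (((algebraMap (Localization.Away hh) ↥(cobordantAlgebra (fun i => algebraMap (MvPolynomial (Fin 4) k) (Localization.Away hh) (X ((![0, 1, 2] : Fin 3 → Fin 4) i))) (![3, 1, 2] : Fin 3 → ℕ))) (algebraMap (MvPolynomial (Fin 4) k) (Localization.Away hh) (C (2 * (1 - 3 * a))))) * (cobordantAlgebra.u' (fun i => algebraMap (MvPolynomial (Fin 4) k) (Localization.Away hh)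 (X ((![0, 1, 2] : Fin 3 → Fin 4) i))) (![3, 1, 2] : Fin 3 → ℕ) 1) + 2 * (cobordantAlgebra.s (fun i => algebraMap (MvPolynomial (Fin 4) k) (Localization.Away hh) (X ((![0, 1, 2] : Fin 3 → Fin 4) i))) (![3, 1, 2] : Fin 3 → ℕ)) * (cobordantAlgebra.u' (fun i => algebraMap (MvPolynomial (Fin 4) k) (Localization.Away hh) (X ((![0, 1, 2] : Fin 3 → Fin 4) i))) (![3, 1, 2] : Fin 3 → ℕ) 2) - 3 * (cobordantAlgebra.s (fun i => algebraMap (MvPolynomial (Fin 4) k) (Localization.Away hh) (X ((![0, 1, 2] : Fin 3 → Fin 4) i))) (![3, 1, 2] : Fin 3 → ℕ)) * (cobordantAlgebra.u' (fun i => algebraMap (MvPolynomial (Fin 4) k) (Localization.Away hh) (X ((![0, 1, 2] : Fin 3 → Fin 4) i))) (![3, 1, 2] : Fin 3 → ℕ) 1) ^ 2) ∉ Q := by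
  have hw0 : (![3, 1, 2] : Fin 3 → ℕ) 0 = (![3, 1, 2] : Fin 3 → ℕ) 1 + 2 := by decide
  -- ### the transported primes
  let Q' : Ideal (Localization.Away qd) := Q.comap Φ.symm
  haveI hQ' : Q'.IsPrime := Ideal.IsPrime.comap Φ.symm
  let Q'' : Ideal (MvPolynomial (Option (Fin 4)) k) := Q'.comap (algebraMap (MvPolynomial (Option (Fin 4)) k) (Localization.Away qd))
  haveI hQ'' : Q''.IsPrime := Ideal.IsPrime.comap _
  have hiff : ∀ x : (ChartRing 𝒜 (fun i => algebraMap (MvPolynomial (Fin 4) k) (Localization.Away hh) (X ((![0, 1, 2] : Fin 3 → Fin 4) i))) (![3, 1, 2] : Fin 3 → ℕ) dbar y hy), x ∈ Q ↔ Φ x ∈ Q' := fun x => by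
    change x ∈ Q ↔ Φ x ∈ Q.comap Φ.symm
    rw [Ideal.mem_comap, RingEquiv.symm_apply_apply]
  have hiffM : ∀ m : (MvPolynomial (Option (Fin 4)) k), m ∈ Q'' ↔ (algebraMap (MvPolynomial (Option (Fin 4)) k) (Localization.Away qd)) m ∈ Q' := fun m => Ideal.mem_comap
  have hnu : ∀ m : (MvPolynomial (Option (Fin 4)) k), IsUnit ((algebraMap (MvPolynomial (Option (Fin 4)) k) (Localization.Away qd)) m) → m ∉ Q'' := fun m hm hmQ =>
    hQ'.ne_top (Q'.eq_top_of_isUnit_mem ((hiffM m).mp hmQ) hm)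
  -- ### constants
  have e2c : (C (2 * c) : (MvPolynomial (Option (Fin 4)) k)) = 2 * C c := by rw [C_mul, map_ofNat]
  have e13 : (C (1 - 3 * a) : (MvPolynomial (Option (Fin 4)) k)) = 1 - 3 * C a := by rw [C_sub, C_1, C_mul, map_ofNat]
  have e2' : (C (2 * (1 - 3 * a)) : (MvPolynomial (Option (Fin 4)) k)) = 2 * (1 - 3 * C a) := by rw [C_mul, map_ofNat, e13]
  have hu2M : IsUnit (2 : (MvPolynomial (Option (Fin 4)) k)) := by rw [← map_ofNat (C : k →+* (MvPolynomial (Option (Fin 4)) k)) 2]; exact (IsUnit.mk0 _ hk2).map C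
  have h9k : (9 : k) ≠ 0 := by rw [show (9 : k) = 3 ^ 2 by norm_num]; exact pow_ne_zero 2 hk3
  have hu9M : IsUnit (9 : (MvPolynomial (Option (Fin 4)) k)) := by rw [← map_ofNat (C : k →+* (MvPolynomial (Option (Fin 4)) k)) 9]; exact (IsUnit.mk0 _ h9k).map C
  have hucM : IsUnit (C c : (MvPolynomial (Option (Fin 4)) k)) := (IsUnit.mk0 _ hc0).map C
  have h9a : (9 : (MvPolynomial (Option (Fin 4)) k)) * C a = 4 := by rw [← map_ofNat (C : k →+* (MvPolynomial (Option (Fin 4)) k)) 9, ← map_mul, mul_comm, ha9, map_ofNat]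
  have h2cM : (2 : (MvPolynomial (Option (Fin 4)) k)) * C c = 3 * C a ^ 2 := by
    rw [← map_ofNat (C : k →+* (MvPolynomial (Option (Fin 4)) k)) 2, ← map_ofNat (C : k →+* (MvPolynomial (Option (Fin 4)) k)) 3, ← map_pow, ← map_mul, ← map_mul, hQ1]
  have hc2M : (C c : (MvPolynomial (Option (Fin 4)) k)) ^ 2 = C a ^ 3 := by rw [← map_pow, ← map_pow, hQ2]
  -- ### the residual generators in the model: `x₀′`, `T′`
  have hX₀ : (X (some 0) : (MvPolynomial (Option (Fin 4)) k)) ∈ Q'' := by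
    have hu := hΦu 0
    change _ = (algebraMap (MvPolynomial (Option (Fin 4)) k) (Localization.Away qd)) (X (some 0)) at hu
    rw [hiffM, ← hu]
    exact (hiff _).mp hu0
  have hT : (X none ^ 2 * X (some 2) ^ 2 + 2 * X none * X (some 2) * X (some 1) + 2 * C c * X (some 2) + (1 - 3 * C a) * X (some 1) ^ 2 - X none * X (some 1) ^ 3 : (MvPolynomial (Option (Fin 4)) k)) ∈ Q'' := by
    have hφ : (X none ^ 2 * X (some 2) ^ 2 + 2 * X none * X (some 2) * X (some 1) + C (2 * c) * X (some 2) + C (1 - 3 * a) * X (some 1) ^ 2 - X none * X (some 1) ^ 3 : MvPolynomial (Option (Fin 4)) k) ∈ Q'' := by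
      rw [hiffM, ← qhc_tail_eq (X 2 ^ 2 + 2 * X 1 * X 2 + C (2 * c) * X 2 + C (1 - 3 * a) * X 1 ^ 2 - X 1 ^ 3 : MvPolynomial (Fin 4) k) (![3, 1, 2] : Fin 3 → ℕ) 2 hh mo 𝒜 y hy hq0 Φ hΦa hΦs ht (X none ^ 2 * X (some 2) ^ 2 + 2 * X none * X (some 2) * X (some 1) + C (2 * c) * X (some 2) + C (1 - 3 * a) * X (some 1) ^ 2 - X none * X (some 1) ^ 3 : MvPolynomial (Option (Fin 4)) k) (QhSym.subst_cuspTailQ (k := k) a c)]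
      exact (hiff _).mp htt
    rw [e2c, e13] at hφ
    exact hφ
  -- ### the unit `subst hh_Q = ∏ₗ (s y′ + a + l s³ x₀′)`
  have hsubX : ∀ i : Fin 4, cobordantAlgebra.subst k (![3, 1, 2, 0] : Fin 4 → ℕ) (X i) = X none ^ (![3, 1, 2, 0] : Fin 4 → ℕ) i * X (some i) := fun i => by
    rw [cobordantAlgebra.subst, MvPolynomial.eval₂Hom_X']
  have hsubC : ∀ a' : k, cobordantAlgebra.subst k (![3, 1, 2, 0] : Fin 4 → ℕ) (C a') = C a' := fun a' => by rw [cobordantAlgebra.subst, MvPolynomial.eval₂Hom_C]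
  have hsubst_hh : cobordantAlgebra.subst k (![3, 1, 2, 0] : Fin 4 → ℕ) hh = ∏ l : ZMod p, (X none * X (some 1) + C a + ((l.val : (MvPolynomial (Option (Fin 4)) k)) * X none ^ 3) * X (some 0)) := by
    rw [hhh, map_prod]
    refine Finset.prod_congr rfl fun l _ => ?_
    rw [map_add, map_add, map_mul, map_natCast, hsubX, hsubX, hsubC]
    simp only [Matrix.cons_val_one, Matrix.cons_val_zero]
    ring
  have hH : (∏ l : ZMod p, (X none * X (some 1) + C a + ((l.val : (MvPolynomial (Option (Fin 4)) k)) * X none ^ 3) * X (some 0))) ∉ Q'' := by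
    rw [← hsubst_hh]; exact hnu _ hUh
  -- ### the certificate, by cases on the inverted cover
  have hcert : (2 * (1 - 3 * C a) * X (some 1) + 2 * X none * X (some 2) - 3 * X none * X (some 1) ^ 2 : (MvPolynomial (Option (Fin 4)) k)) ∉ Q'' ∧
      (∏ l : ZMod p, (2 * (1 - 3 * C a) * (X (some 1) + ((l.val : (MvPolynomial (Option (Fin 4)) k)) * X none ^ 2) * X (some 0)) + 2 * X none * X (some 2) - 3 * X none * (X (some 1) + ((l.val : (MvPolynomial (Option (Fin 4)) k)) * X none ^ 2) * X (some 0)) ^ 2)) ∉ Q'' := by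
    by_cases hY : (X (some 1) : (MvPolynomial (Option (Fin 4)) k)) ∈ Q''
    · rcases hcov with hN | hV
      · refine absurd ?_ (hnu _ hN)
        have e : (∏ l : ZMod p, (X (some 1) + (l.val : (MvPolynomial (Option (Fin 4)) k)) * (X none ^ 2 * X (some 0)))) = ∏ l : ZMod p, (X (some 1) + ((l.val : (MvPolynomial (Option (Fin 4)) k)) * X none ^ 2) * X (some 0)) := Finset.prod_congr rfl fun l _ => by ring
        rw [e]
        exact (Cusp.prod_add_mul_mem_iff Q'' (X (some 1)) (X (some 0)) _ hX₀).mpr hY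
      · exact Cusp.cuspQ_hunit_not_mem_of_Y_mem Q'' (X none) (X (some 0)) (X (some 1)) (X (some 2)) (C a) (C c) (fun l : ZMod p => (l.val : (MvPolynomial (Option (Fin 4)) k)) * X none ^ 2)
          hu2M hucM (hnu _ hV) hX₀ hT hY
    · have hNY : (∏ l : ZMod p, (X (some 1) + ((l.val : (MvPolynomial (Option (Fin 4)) k)) * X none ^ 2) * X (some 0))) ∉ Q'' := fun h =>
        hY ((Cusp.prod_add_mul_mem_iff Q'' (X (some 1)) (X (some 0)) _ hX₀).mp h)
      exact Cusp.cuspQ_hunit_not_mem Q'' (X none) (X (some 0)) (X (some 1)) (X (some 2)) (C a) (C c)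
        (fun l : ZMod p => (l.val : (MvPolynomial (Option (Fin 4)) k)) * X none ^ 3) (fun l : ZMod p => (l.val : (MvPolynomial (Option (Fin 4)) k)) * X none ^ 2) (fun l : ZMod p => (l.val : (MvPolynomial (Option (Fin 4)) k)) * X none ^ 2)
        hu2M hu9M h9a h2cM hc2M hX₀ hT hH hNY
  obtain ⟨hO, hNH⟩ := hcert
  -- ### transport back to `R_c`
  have hu2 := hΦu 2
  change _ = (algebraMap (MvPolynomial (Option (Fin 4)) k) (Localization.Away qd)) (X (some 2)) at hu2
  have hu1 := hΦu 1
  change _ = (algebraMap (MvPolynomial (Option (Fin 4)) k) (Localization.Away qd)) (X (some 1)) at hu1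
  have hca : Φ ((algebraMap ↥(cobordantAlgebra (fun i => algebraMap (MvPolynomial (Fin 4) k) (Localization.Away hh) (X ((![0, 1, 2] : Fin 3 → Fin 4) i))) (![3, 1, 2] : Fin 3 → ℕ)) (ChartRing 𝒜 (fun i => algebraMap (MvPolynomial (Fin 4) k) (Localization.Away hh) (X ((![0, 1, 2] : Fin 3 → Fin 4) i))) (![3, 1, 2] : Fin 3 → ℕ) dbar y hy)) ((algebraMap (Localization.Away hh) ↥(cobordantAlgebra (fun i => algebraMap (MvPolynomial (Fin 4) k) (Localization.Away hh) (X ((![0, 1, 2] : Fin 3 → Fin 4) i))) (![3, 1, 2] : Fin 3 → ℕ))) (algebraMap (MvPolynomial (Fin 4) k) (Localization.Away hh) (C a)))) = (algebraMap (MvPolynomial (Option (Fin 4)) k) (Localization.Away qd)) (C a) := by rw [hΦa, hsubC]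
  refine ⟨fun h => hNH ?_, fun h => hO ?_⟩
  · have h' := (hiff _).mp h
    rw [qhc_map_normR_hHatQ σ hC h0 h1 h2 (X 2 ^ 2 + 2 * X 1 * X 2 + C (2 * c) * X 2 + C (1 - 3 * a) * X 1 ^ 2 - X 1 ^ 3 : MvPolynomial (Fin 4) k) h3 (![3, 1, 2] : Fin 3 → ℕ) 2 hw0 hh hσh hp hσpL hσJ mo 𝒜 y hy hσy Φ hΦa hΦs hΦu (2 * (1 - 3 * a))] at h'
    have e : (∏ j : ZMod p, (C (2 * (1 - 3 * a)) * (X (some 1) + (j.val : (MvPolynomial (Option (Fin 4)) k)) * (X none ^ 2 * X (some 0))) + 2 * X none * X (some 2) -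
        3 * X none * (X (some 1) + (j.val : (MvPolynomial (Option (Fin 4)) k)) * (X none ^ 2 * X (some 0))) ^ 2) : (MvPolynomial (Option (Fin 4)) k)) =
        ∏ l : ZMod p, (2 * (1 - 3 * C a) * (X (some 1) + ((l.val : (MvPolynomial (Option (Fin 4)) k)) * X none ^ 2) * X (some 0)) + 2 * X none * X (some 2) - 3 * X none * (X (some 1) + ((l.val : (MvPolynomial (Option (Fin 4)) k)) * X none ^ 2) * X (some 0)) ^ 2) :=
      Finset.prod_congr rfl fun l _ => by rw [e2']; ring
    rw [e] at h'
    exact (hiffM _).mpr h'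
  · have h' := (hiff _).mp h
    have heq : Φ ((algebraMap ↥(cobordantAlgebra (fun i => algebraMap (MvPolynomial (Fin 4) k) (Localization.Away hh) (X ((![0, 1, 2] : Fin 3 → Fin 4) i))) (![3, 1, 2] : Fin 3 → ℕ)) (ChartRing 𝒜 (fun i => algebraMap (MvPolynomial (Fin 4) k) (Localization.Away hh) (X ((![0, 1, 2] : Fin 3 → Fin 4) i))) (![3, 1, 2] : Fin 3 → ℕ) dbar y hy)) (((algebraMap (Localization.Away hh) ↥(cobordantAlgebra (fun i => algebraMap (MvPolynomial (Fin 4) k) (Localization.Away hh) (X ((![0, 1, 2] : Fin 3 → Fin 4) i))) (![3, 1, 2] : Fin 3 → ℕ))) (algebraMap (MvPolynomial (Fin 4) k) (Localization.Away hh) (C (2 * (1 - 3 * a))))) * (cobordantAlgebra.u' (fun i => algebraMap (MvPolynomial (Fin 4) k) (Localization.Away hh) (X ((![0, 1, 2] : Fin 3 → Fin 4) i))) (![3, 1, 2] : Fin 3 → ℕ) 1) + 2 * (cobordantAlgebra.s (fun i => algebraMap (MvPolynomial (Fin 4) k) (Localization.Away hh) (X ((![0, 1, 2] : Fin 3 →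 Fin 4) i))) (![3, 1, 2] : Fin 3 → ℕ)) * (cobordantAlgebra.u' (fun i => algebraMap (MvPolynomial (Fin 4) k) (Localization.Away hh) (X ((![0, 1, 2] : Fin 3 → Fin 4) i))) (![3, 1, 2] : Fin 3 → ℕ) 2) - 3 * (cobordantAlgebra.s (fun i => algebraMap (MvPolynomial (Fin 4) k) (Localization.Away hh) (X ((![0, 1, 2] : Fin 3 → Fin 4) i))) (![3, 1, 2] : Fin 3 → ℕ)) * (cobordantAlgebra.u' (fun i => algebraMap (MvPolynomial (Fin 4) k) (Localization.Away hh) (X ((![0, 1, 2] : Fin 3 → Fin 4) i))) (![3, 1, 2] : Fin 3 → ℕ) 1) ^ 2)) = (algebraMap (MvPolynomial (Option (Fin 4)) k) (Localization.Away qd)) (2 * (1 - 3 * C a) * X (some 1) + 2 * X none * X (some 2) - 3 * X none * X (some 1) ^ 2) := by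
      simp only [map_sub, map_add, map_mul, map_pow, map_ofNat, map_one, hu2, hu1, hΦs, hca]
    rw [heq] at h'
    exact (hiffM _).mpr h'

set_option maxHeartbeats 1600000 in
set_option synthInstance.maxHeartbeats 400000 in
include hC h0 h1 h2 h3 hΦa hΦs hΦu hσy hq0 in
/-- ★ **The chart value of `b_Q` is not in a residual prime.** On a producer chart ring over `W_Q` whose model inverts `N(y′)` or `v′`, a prime `Q`
containing the RESIDUAL SECTIONS `u₀′^{n₀}/c` and `t̂ⁿ/c` (`n₀, n > 0`) does not contain `(N_R(ĥ_Q)^{d′})/1 · (1/c)^{e}` — for `d′ = dbar`, `e = 1·p`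
literally the chart value `E b` of the member opens `U_{Q,1}` (✓`exists_cuspQ_memberChart_rel`) and `U_{Q,2}` (✓`exists_cuspQv_memberChart_rel`).
[OURS · L1 W4.5c · R4c (C1) at `Q`] -/
theorem cuspQ_bHat_not_mem_of_residualSections [NeZero p] (hk2 : (2 : k) ≠ 0) (hk3 : (3 : k) ≠ 0) (hc0 : c ≠ 0) (ha9 : a * 9 = 4)
    (hQ1 : 2 * c = 3 * a ^ 2) (hQ2 : c ^ 2 = a ^ 3)
    (hhh : hh = ∏ l : ZMod p, (X 1 + C a + (l.val : (MvPolynomial (Fin 4) k)) * X 0))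
    (hUh : IsUnit ((algebraMap (MvPolynomial (Option (Fin 4)) k) (Localization.Away qd)) (cobordantAlgebra.subst k (![3, 1, 2, 0] : Fin 4 → ℕ) hh)))
    (hcov : IsUnit ((algebraMap (MvPolynomial (Option (Fin 4)) k) (Localization.Away qd)) (∏ l : ZMod p, (X (some 1) + (l.val : (MvPolynomial (Option (Fin 4)) k)) * (X none ^ 2 * X (some 0))))) ∨ IsUnit ((algebraMap (MvPolynomial (Option (Fin 4)) k) (Localization.Away qd)) (X (some 2))))
    (Q : Ideal (ChartRing 𝒜 (fun i => algebraMap (MvPolynomial (Fin 4) k) (Localization.Away hh) (X ((![0, 1, 2] : Fin 3 → Fin 4) i))) (![3, 1, 2] : Fin 3 → ℕ) dbar y hy)) [hQ : Q.IsPrime]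
    {n₀ n : ℕ} (hn₀ : 0 < n₀) (hn : 0 < n)
    (h0sec : (algebraMap ↥(cobordantAlgebra (fun i => algebraMap (MvPolynomial (Fin 4) k) (Localization.Away hh) (X ((![0, 1, 2] : Fin 3 → Fin 4) i))) (![3, 1, 2] : Fin 3 → ℕ)) (ChartRing 𝒜 (fun i => algebraMap (MvPolynomial (Fin 4) k) (Localization.Away hh) (X ((![0, 1, 2] : Fin 3 → Fin 4) i))) (![3, 1, 2] : Fin 3 → ℕ) dbar y hy)) ((cobordantAlgebra.u' (fun i => algebraMap (MvPolynomial (Fin 4) k) (Localization.Away hh) (X ((![0, 1, 2] : Fin 3 → Fin 4) i))) (![3, 1, 2] : Fin 3 → ℕ) 0) ^ n₀) * IsLocalization.Away.invSelf (coverElement 𝒜 (fun i => algebraMap (MvPolynomial (Fin 4) k) (Localization.Away hh) (X ((![0, 1, 2] : Fin 3 → Fin 4) i))) (![3, 1, 2] : Fin 3 → ℕ) dbar y hy) ∈ Q)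
    (h1sec : (algebraMap ↥(cobordantAlgebra (fun i => algebraMap (MvPolynomial (Fin 4) k) (Localization.Away hh) (X ((![0, 1, 2] : Fin 3 → Fin 4) i))) (![3, 1, 2] : Fin 3 → ℕ)) (ChartRing 𝒜 (fun i => algebraMap (MvPolynomial (Fin 4) k) (Localization.Away hh) (X ((![0, 1, 2] : Fin 3 → Fin 4) i))) (![3, 1, 2] : Fin 3 → ℕ) dbar y hy)) (((⟨_, C_mul_T_mem_cobordantAlgebra _ _ ht⟩ : ↥(cobordantAlgebra (fun i => algebraMap (MvPolynomial (Fin 4) k) (Localization.Away hh) (X ((![0, 1, 2] : Fin 3 → Fin 4) i))) (![3, 1, 2] : Fin 3 → ℕ)))) ^ n) * IsLocalization.Away.invSelf (coverElement 𝒜 (fun i => algebraMap (MvPolynomial (Fin 4) k) (Localization.Away hh) (X ((![0, 1, 2] : Fin 3 → Fin 4) i))) (![3, 1, 2] : Fin 3 → ℕ) dbar y hy) ∈ Q)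
    (d' e : ℕ) :
    (algebraMap ↥(cobordantAlgebra (fun i => algebraMap (MvPolynomial (Fin 4) k) (Localization.Away hh) (X ((![0, 1, 2] : Fin 3 → Fin 4) i))) (![3, 1, 2] : Fin 3 → ℕ)) (ChartRing 𝒜 (fun i => algebraMap (MvPolynomial (Fin 4) k) (Localization.Away hh) (X ((![0, 1, 2] : Fin 3 → Fin 4) i))) (![3, 1, 2] : Fin 3 → ℕ) dbar y hy)) ((∏ j : ZMod p, (⇑(sigmaR (sigmaAway σ hσh) (fun i => algebraMap (MvPolynomial (Fin 4) k) (Localization.Away hh) (X ((![0, 1, 2] : Fin 3 → Fin 4) i))) (![3, 1, 2] : Fin 3 → ℕ) hσJ hp hσpL))^[j.val] (((algebraMap (Localization.Away hh) ↥(cobordantAlgebra (fun i => algebraMap (MvPolynomial (Fin 4) k) (Localization.Away hh) (X ((![0, 1, 2] : Fin 3 → Fin 4) i))) (![3, 1, 2] : Fin 3 → ℕ))) (algebraMap (MvPolynomial (Fin 4) k) (Localization.Away hh) (C (2 * (1 - 3 * a))))) * (cobordantAlgebra.u' (fun i => algebraMap (MvPolynomial (Fin 4) k) (Localization.Away hh)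 (X ((![0, 1, 2] : Fin 3 → Fin 4) i))) (![3, 1, 2] : Fin 3 → ℕ) 1) + 2 * (cobordantAlgebra.s (fun i => algebraMap (MvPolynomial (Fin 4) k) (Localization.Away hh) (X ((![0, 1, 2] : Fin 3 → Fin 4) i))) (![3, 1, 2] : Fin 3 → ℕ)) * (cobordantAlgebra.u' (fun i => algebraMap (MvPolynomial (Fin 4) k) (Localization.Away hh) (X ((![0, 1, 2] : Fin 3 → Fin 4) i))) (![3, 1, 2] : Fin 3 → ℕ) 2) - 3 * (cobordantAlgebra.s (fun i => algebraMap (MvPolynomial (Fin 4) k) (Localization.Away hh) (X ((![0, 1, 2] : Fin 3 → Fin 4) i))) (![3, 1, 2] : Fin 3 → ℕ)) * (cobordantAlgebra.u' (fun i => algebraMap (MvPolynomial (Fin 4) k) (Localization.Away hh) (X ((![0, 1, 2] : Fin 3 → Fin 4) i))) (![3, 1, 2] : Fin 3 → ℕ) 1) ^ 2)) ^ d') * IsLocalization.Away.invSelf (coverElement 𝒜 (fun i => algebraMap (MvPolynomial (Fin 4) k) (Localization.Away hh) (X ((![0, 1, 2] : Fin 3 → Fin 4) i))) (![3, 1, 2]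 : Fin 3 → ℕ) dbar y hy) ^ e ∉ Q := by
  obtain ⟨hu0, htt⟩ := QhAbs.mem_of_residualSections_mem (fun i => algebraMap (MvPolynomial (Fin 4) k) (Localization.Away hh) (X ((![0, 1, 2] : Fin 3 → Fin 4) i))) (algebraMap (MvPolynomial (Fin 4) k) (Localization.Away hh) (X 2 ^ 2 + 2 * X 1 * X 2 + C (2 * c) * X 2 + C (1 - 3 * a) * X 1 ^ 2 - X 1 ^ 3 : MvPolynomial (Fin 4) k)) (![3, 1, 2] : Fin 3 → ℕ) 2 ht mo 𝒜 y hy n₀ n Q h0sec h1sec hn₀ hn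
  obtain ⟨hNH, -⟩ := cuspQ_hHat_not_mem_of_residual a c σ hC h0 h1 h2 h3 hh hσh hp hσpL hσJ ht mo 𝒜 y hy hσy hq0 Φ hΦa hΦs hΦu hk2 hk3 hc0 ha9 hQ1 hQ2 hhh hUh hcov Q hu0 htt
  have hunit : IsUnit (IsLocalization.Away.invSelf (S := (ChartRing 𝒜 (fun i => algebraMap (MvPolynomial (Fin 4) k) (Localization.Away hh) (X ((![0, 1, 2] : Fin 3 → Fin 4) i))) (![3, 1, 2] : Fin 3 → ℕ) dbar y hy)) (coverElement 𝒜 (fun i => algebraMap (MvPolynomial (Fin 4) k) (Localization.Away hh) (X ((![0, 1, 2] : Fin 3 → Fin 4) i))) (![3, 1, 2] : Fin 3 → ℕ) dbar y hy)) :=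
    IsUnit.of_mul_eq_one (algebraMap _ (ChartRing 𝒜 (fun i => algebraMap (MvPolynomial (Fin 4) k) (Localization.Away hh) (X ((![0, 1, 2] : Fin 3 → Fin 4) i))) (![3, 1, 2] : Fin 3 → ℕ) dbar y hy) (coverElement 𝒜 (fun i => algebraMap (MvPolynomial (Fin 4) k) (Localization.Away hh) (X ((![0, 1, 2] : Fin 3 → Fin 4) i))) (![3, 1, 2] : Fin 3 → ℕ) dbar y hy)) (by rw [mul_comm]; exact IsLocalization.Away.mul_invSelf _)
  intro h
  rcases hQ.mem_or_mem h with h | h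
  · rw [map_pow] at h
    exact hNH (hQ.mem_of_pow_mem _ h)
  · exact hQ.ne_top (Q.eq_top_of_isUnit_mem h (hunit.pow e))

end Summit.ResolutionOfSingularities.ResolutionOfSingularities.Theorems.WildQuotientResolution.S1.KillCert.QhAway

end
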